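import Summits.ABC.IUTFork.Thm311RealInd1StripPrimeDichotomyInput
import HarnessLib

/-!
# [IUTchIII] Thm 3.11 (i) (Ind1)+(Ind2) ⟶ Cor 3.12, GLOBAL level (all support primes `T(I)` of a genuine Θ-volume input): the nonarchimedean Θ-side
# computed over print's (Ind1)⊔(Ind2) AS TYPED is `≤` Dupuy–Hilado's `−|log(Θ)|^{(P),nonarch}` / `−|log(Θ)|^{nonarch}` for EVERY prime-indexed family of
# sub-indeterminacies `H_p ≤ indTwo`, and STRICTLY below it as soon as ONE support prime carries ONE tame collection failing its room test; so Cor 3.12's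
# nonarchimedean form over print's indeterminacies AS TYPED implies Dupuy–Hilado's (1.1), with R29's margin to spare at such data (UNCONDITIONAL)

PROOF-ONLY file (abc-iut cell, Cor. 3.12 sub-crew, seat abc-iut-c312-1 = holder of record of the typed [IUTchIII] Thm. 3.11, gen 22; offer (σ)
«C:GLOBAL-STRICTNESS», sequel of row R30 `Thm311RealInd1StripPrimeDichotomyInput` (p588176)).  TAKES NO SIDE on [IUTchIII] Cor. 3.12.  No definition, no
`Prop` fact, NO `JannsenWingbergMappingClass`: everything UNCONDITIONAL.  Nothing here is a new estimate: the file SUMS abc-iut-c312-d1's per-prime monotonicity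
(`GenuineLogThetaPerImageSubIndeterminacy` / `GenuineLogThetaUnionSubIndeterminacy`) and gen 21/22's per-prime strict drops over abc-iut-S2's support set `T(I)`.

SETTING.  A genuine Θ-volume input `I : ThetaVolumeInput F₀ K` (abc-iut-S2 `GenuineLogTheta`: section `σ`, Θ-idele `tΘ`, support primes `T(I) = supportPrimes`,
`negLogThetaNonarch I = Σ_{p∈T(I)} negLogThetaLoc I p` (reading (U)), `negLogThetaPerImageNonarch I = Σ_{p∈T(I)} negLogThetaPerImageLoc I p` (reading (P)),
claim forms `Cor312NonarchOf I : −|log(q)| ≤ negLogThetaNonarch I` / `Cor312PerImageNonarchOf I`), and a PRIME-INDEXED family `H = (H_{p,j,v⃗})` of subgroups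
of the packet automorphisms at every prime `p` with `H_{p,j,v⃗} ≤ indTwo` (the Dupuy–Hilado container).  «The nonarchimedean Θ-side over `H`» is written INLINE
(no definition): `Σ_{p∈T(I)} ln ν̄_{𝕃_p}(v⃗ ↦ hull(⋃_{g∈H_{p,v⃗}} g(O_𝕃(−P_Θ)_{v⃗})))` for reading (P), resp. with the (Ind1)-slot union `⋃_σ σ·O_𝕃(−P_Θ)_{v⃗∘σ}`
for reading (U) (abc-iut-c312-d1's `H`-shapes), each summand guarded by `if p.Prime` exactly as `negLogThetaLoc`.
* §1 per prime (input-level ports of abc-iut-c312-d1's monotonicity): `lnνLp_hull_orbitH_le_negLogThetaPerImageLoc`, `lnνLp_hull_orbitH_indOneUnion_le_negLogThetaLoc`.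
* §2 GLOBAL MONOTONICITY **`sum_lnνLp_hull_orbitH_le_negLogThetaPerImageNonarch`** / **`sum_lnνLp_hull_orbitH_indOneUnion_le_negLogThetaNonarch`**.
* §3 GLOBAL STRICTNESS **`sum_lnνLp_hull_orbitH_lt_negLogThetaPerImageNonarch_of_not_room_mixed`** / **`sum_lnνLp_hull_orbitH_indOneUnion_lt_negLogThetaNonarch_of_not_room_at_min`**:
  ONE support prime `p₀ > 2` with ONE collection `v⃗₁` (degree `j₁ ≤ ℓ⋆`) of TAME factors, bits only on `S` (off `S`: residue degree one, `e ≥ 2`, `hfix`), failing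
  its room test (at the twisted slot for (P); at every content-minimising slot for (U)), `H_{p₀,v⃗₁}` factorwise through the realised strip groups ⟹ `<` (R30 (ρ3)
  `lnνLp_hull_orbitH_lt_negLogThetaPerImageLoc_of_not_room_mixed` / `…indOneUnion_lt_negLogThetaLoc_of_not_room_at_min` at `p₀`, `≤` elsewhere, `Finset.sum_lt_sum`).
* §4 CLAIM-FORM TRANSFER: **`cor312PerImageNonarchOf_of_negAbsLogQ_le_sum`** / **`cor312NonarchOf_of_negAbsLogQ_le_sum`** — «Cor 3.12's nonarchimedean form over
  `H`» (`−|log(q)| ≤` the `H`-sum) implies abc-iut-S2's Dupuy–Hilado forms; with §3 (`lt_of_le_of_lt`) it implies them STRICTLY at any input carrying a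
  failing-room collection at an odd support prime.
READING (numbers about OUR typed objects; neutral): R29/R30 priced ONE failing collection at ONE prime; this file carries the price to the level at which the cell's
claim forms live: over print's (Ind1)⊔(Ind2) AS TYPED (any prime-indexed factorwise-strip family inside the container) the nonarchimedean Θ-side never
exceeds Dupuy–Hilado's and falls STRICTLY short of it at any input with one failing-room collection at an odd support prime; there Cor. 3.12's nonarchimedean
form AS TYPED over `H` is a STRICTLY STRONGER assertion than Dupuy–Hilado's (1.1).  Which value a bit takes, and whether a given input has such a collection,
is NOT claimed; the archimedean summand (the same closed form `((l+5)/4)·log π` on both sides) is not touched.  HONEST SCOPE: unconditional; OUR typings (THE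
equivariant lift, THE logarithm, factorwise action; F-B28-1 untouched); equal-AS-TYPED ≠ equal in print; nothing here asserts that abc is proved or refuted; no
side taken on [IUTchIII] Cor. 3.12 / [IUTchIV] Thm. 1.10, on (U) vs (P), or on any author. [claim: Mochizuki2012, status: disputed]; [cite: Mochizuki2012,
IUTchIII Thm. 3.11 (i) p. 154; Cor. 3.12 pp. 173–174, Steps (x)/(xi) pp. 181–183; IUTchIV Thm. 1.10 Steps (v)–(viii) pp. 27–31, Prop. 1.4 (iii) p. 13];
[cite: DupuyHilado2025, §1 (1.1), Def. 3.6.3, §4.7, §4.9, §4.11, §4.12]. typed ≠ proved.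
-/

set_option autoImplicit false

noncomputable section

open Metric Set Function Module
open scoped Pointwise TensorProduct

namespace Literature.IUT.LogVolume.ThetaVolumeInput

open Summit.ABC.IUTFork.Thm311.Real Literature.NumberTheory.NumberFields Function
open Literature.NumberTheory.GaloisRepresentations Literature.NumberTheory.GaloisRepresentations.Ultrametric
open Literature.AnabelianGeometry.AbsoluteAnabelian Literature.IUT.HodgeArakelov
open Literature.IUT.HodgeArakelov.AbsTopMonoids NumberField IsDedekindDomain

variable {F₀ : Type} [Field F₀] [NumberField F₀] {K : Type} [Field K] [NumberField K] [Algebra F₀ K]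
variable (I : ThetaVolumeInput F₀ K)

/-! ## §1 Per prime: abc-iut-c312-d1's monotonicity at the input level -/

/-- **Per prime, reading (P): `ln ν̄_{𝕃_p}(reading (P) over H) ≤ negLogThetaPerImageLoc I p`** for every family `H ≤ indTwo` at `p`
(abc-iut-c312-d1's `realPrimePacketWith_lnνLp_hull_orbitH_le_negLogThetaPerImageAt` at `σ := I.σ`, `t := I.tΘ p`). [claim: Mochizuki2012, status: disputed]
[cite: Mochizuki2012, IUTchIII Cor. 3.12 proof Step (x) p. 181] [cite: DupuyHilado2025, §4.9, §4.12] -/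
theorem lnνLp_hull_orbitH_le_negLogThetaPerImageLoc {p : ℕ} (hp : p.Prime)
    (H : haveI : Fact p.Prime := ⟨hp⟩
      (j : ℕ) → (e : Fin (j + 1) → placesOver F₀ p) →
        Subgroup (PacketAlgebra p (fun b => (I.σ.localFields p).k (e b)) ≃ₗ[ℚ_[p]]
          PacketAlgebra p (fun b => (I.σ.localFields p).k (e b))))
    (hH : haveI : Fact p.Prime := ⟨hp⟩; ∀ j e, H j e ≤ indTwo p (fun b => (I.σ.localFields p).k (e b))) :
    haveI : Fact p.Prime := ⟨hp⟩
    (I.packetAt p hp).lnνLp I.lstar (fun j e =>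
        packetHull p (fun b => (I.σ.localFields p).k (e b))
          (⋃ g : H j e, (g : PacketAlgebra p (fun b => (I.σ.localFields p).k (e b)) ≃ₗ[ℚ_[p]]
              PacketAlgebra p (fun b => (I.σ.localFields p).k (e b))) ''
            (I.packetAt p hp).pilotRegion (I.tΘ p hp) j e)) ≤
      I.negLogThetaPerImageLoc p := by
  haveI : Fact p.Prime := ⟨hp⟩
  rw [negLogThetaPerImageLoc_of_prime I hp]
  exact realPrimePacketWith_lnνLp_hull_orbitH_le_negLogThetaPerImageAt p (I.σ.localFields p) (mScale p (I.σ.localFields p))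
    (mScale_ne_zero p (I.σ.localFields p)) (mScale_perm p (I.σ.localFields p)) (I.tΘ p hp) H hH

/-- **Per prime, reading (U): `ln ν̄_{𝕃_p}(reading (U) over H) ≤ negLogThetaLoc I p`** for every family `H ≤ indTwo` at `p`
(abc-iut-c312-d1's `realPrimePacketWith_lnνLp_hull_orbitH_slotUnion_le_negLogThetaAt` at `σ := I.σ`, `t := I.tΘ p`). [claim: Mochizuki2012, status: disputed]
[cite: Mochizuki2012, IUTchIII Cor. 3.12 p. 174] [cite: DupuyHilado2025, §4.9, §4.11, §4.12] -/
theorem lnνLp_hull_orbitH_indOneUnion_le_negLogThetaLoc {p : ℕ} (hp : p.Prime)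
    (H : haveI : Fact p.Prime := ⟨hp⟩
      (j : ℕ) → (e : Fin (j + 1) → placesOver F₀ p) →
        Subgroup (PacketAlgebra p (fun b => (I.σ.localFields p).k (e b)) ≃ₗ[ℚ_[p]]
          PacketAlgebra p (fun b => (I.σ.localFields p).k (e b))))
    (hH : haveI : Fact p.Prime := ⟨hp⟩; ∀ j e, H j e ≤ indTwo p (fun b => (I.σ.localFields p).k (e b))) :
    haveI : Fact p.Prime := ⟨hp⟩
    (I.packetAt p hp).lnνLp I.lstar (fun j e =>
        packetHull p (fun b => (I.σ.localFields p).k (e b))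
          (⋃ g : H j e, (g : PacketAlgebra p (fun b => (I.σ.localFields p).k (e b)) ≃ₗ[ℚ_[p]]
              PacketAlgebra p (fun b => (I.σ.localFields p).k (e b))) ''
            ⋃ τ : Equiv.Perm (Fin (j + 1)), (I.packetAt p hp).perm τ e '' (I.packetAt p hp).pilotRegion (I.tΘ p hp) j (e ∘ τ))) ≤
      I.negLogThetaLoc p := by
  haveI : Fact p.Prime := ⟨hp⟩
  rw [negLogThetaLoc_of_prime I hp]
  exact realPrimePacketWith_lnνLp_hull_orbitH_slotUnion_le_negLogThetaAt p (I.σ.localFields p) (mScale p (I.σ.localFields p))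
    (mScale_ne_zero p (I.σ.localFields p)) (mScale_perm p (I.σ.localFields p)) (I.tΘ p hp) H hH

/-! ## §2 Global monotonicity over the support primes -/

/-- **GLOBAL MONOTONICITY, reading (P): the nonarchimedean Θ-side over ANY prime-indexed family `H ≤ indTwo` is `≤ −|log(Θ)|^{(P),nonarch}`.**
`Σ_{p∈T(I)} ln ν̄_{𝕃_p}(reading (P) over H_p) ≤ negLogThetaPerImageNonarch I` (§1 summed over `supportPrimes`). [claim: Mochizuki2012, status: disputed]
[cite: Mochizuki2012, IUTchIII Cor. 3.12 proof Step (x) p. 181; IUTchIV Thm. 1.10 Step (viii) p. 31] [cite: DupuyHilado2025, §1 (1.1), Def. 3.6.3, §4.12] -/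
theorem sum_lnνLp_hull_orbitH_le_negLogThetaPerImageNonarch
    (H : ∀ (p : ℕ) (hp : p.Prime), haveI : Fact p.Prime := ⟨hp⟩
      (j : ℕ) → (e : Fin (j + 1) → placesOver F₀ p) →
        Subgroup (PacketAlgebra p (fun b => (I.σ.localFields p).k (e b)) ≃ₗ[ℚ_[p]]
          PacketAlgebra p (fun b => (I.σ.localFields p).k (e b))))
    (hH : ∀ (p : ℕ) (hp : p.Prime), haveI : Fact p.Prime := ⟨hp⟩; ∀ j e, H p hp j e ≤ indTwo p (fun b => (I.σ.localFields p).k (e b))) :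
    (∑ p ∈ I.supportPrimes, if hp : p.Prime then
        (haveI : Fact p.Prime := ⟨hp⟩
        (I.packetAt p hp).lnνLp I.lstar (fun j e =>
          packetHull p (fun b => (I.σ.localFields p).k (e b))
            (⋃ g : H p hp j e, (g : PacketAlgebra p (fun b => (I.σ.localFields p).k (e b)) ≃ₗ[ℚ_[p]]
                PacketAlgebra p (fun b => (I.σ.localFields p).k (e b))) ''
              (I.packetAt p hp).pilotRegion (I.tΘ p hp) j e))) else 0) ≤
      I.negLogThetaPerImageNonarch := by
  unfold negLogThetaPerImageNonarch
  refine Finset.sum_le_sum fun p hpT => ?_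
  have hp : p.Prime := I.prime_of_mem_supportPrimes hpT
  rw [dif_pos hp]
  exact I.lnνLp_hull_orbitH_le_negLogThetaPerImageLoc hp (H p hp) (hH p hp)

/-- **GLOBAL MONOTONICITY, reading (U): the nonarchimedean Θ-side over ANY prime-indexed family `H ≤ indTwo` is `≤ −|log(Θ)|^{nonarch}`.**
`Σ_{p∈T(I)} ln ν̄_{𝕃_p}(reading (U) over H_p) ≤ negLogThetaNonarch I`. [claim: Mochizuki2012, status: disputed]
[cite: Mochizuki2012, IUTchIII Cor. 3.12 p. 174; IUTchIV Thm. 1.10 Step (viii) p. 31] [cite: DupuyHilado2025, §1 (1.1), Def. 3.6.3, §4.11, §4.12] -/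
theorem sum_lnνLp_hull_orbitH_indOneUnion_le_negLogThetaNonarch
    (H : ∀ (p : ℕ) (hp : p.Prime), haveI : Fact p.Prime := ⟨hp⟩
      (j : ℕ) → (e : Fin (j + 1) → placesOver F₀ p) →
        Subgroup (PacketAlgebra p (fun b => (I.σ.localFields p).k (e b)) ≃ₗ[ℚ_[p]]
          PacketAlgebra p (fun b => (I.σ.localFields p).k (e b))))
    (hH : ∀ (p : ℕ) (hp : p.Prime), haveI : Fact p.Prime := ⟨hp⟩; ∀ j e, H p hp j e ≤ indTwo p (fun b => (I.σ.localFields p).k (e b))) :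
    (∑ p ∈ I.supportPrimes, if hp : p.Prime then
        (haveI : Fact p.Prime := ⟨hp⟩
        (I.packetAt p hp).lnνLp I.lstar (fun j e =>
          packetHull p (fun b => (I.σ.localFields p).k (e b))
            (⋃ g : H p hp j e, (g : PacketAlgebra p (fun b => (I.σ.localFields p).k (e b)) ≃ₗ[ℚ_[p]]
                PacketAlgebra p (fun b => (I.σ.localFields p).k (e b))) ''
              ⋃ τ : Equiv.Perm (Fin (j + 1)), (I.packetAt p hp).perm τ e '' (I.packetAt p hp).pilotRegion (I.tΘ p hp) j (e ∘ τ)))) else 0) ≤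
      I.negLogThetaNonarch := by
  unfold negLogThetaNonarch
  refine Finset.sum_le_sum fun p hpT => ?_
  have hp : p.Prime := I.prime_of_mem_supportPrimes hpT
  rw [dif_pos hp]
  exact I.lnνLp_hull_orbitH_indOneUnion_le_negLogThetaLoc hp (H p hp) (hH p hp)

/-! ## §3 Global strictness from ONE failing-room collection at ONE support prime -/

/-- **GLOBAL STRICTNESS, reading (P) (UNCONDITIONAL).**  If at ONE support prime `p₀ > 2` ONE collection `v⃗₁ = e₁` (degree `j₁ = i₁+1 ≤ ℓ⋆`) has TAME
factors, `‖t_{i₁,v_{1,j₁}}‖ = p₀^{−v/E}`, bits only on `S` (off `S`: residue degree one, `e_b ≥ 2`, no realised strip automorphism moves `ℤ_{p₀}·p₀` modulo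
`p₀·log(𝒪^×)`), FAILS its room inequality at the twisted slot, and `H_{p₀,j₁,v⃗₁}` acts factorwise through the realised strip groups, then the nonarchimedean
Θ-side over `H` is STRICTLY below `−|log(Θ)|^{(P),nonarch}` (by at least R29's margin at `p₀`; R30 (ρ3) at `p₀`, §1 elsewhere).
[claim: Mochizuki2012, status: disputed] [cite: Mochizuki2012, IUTchIII Thm. 3.11 (i) p. 154; Cor. 3.12 proof Step (x) p. 181; IUTchIV Prop. 1.4 (iii) p. 13]
[cite: DupuyHilado2025, §1 (1.1), Def. 3.6.3, §4.9, §4.12] -/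
theorem sum_lnνLp_hull_orbitH_lt_negLogThetaPerImageNonarch_of_not_room_mixed
    (H : ∀ (p : ℕ) (hp : p.Prime), haveI : Fact p.Prime := ⟨hp⟩
      (j : ℕ) → (e : Fin (j + 1) → placesOver F₀ p) →
        Subgroup (PacketAlgebra p (fun b => (I.σ.localFields p).k (e b)) ≃ₗ[ℚ_[p]]
          PacketAlgebra p (fun b => (I.σ.localFields p).k (e b))))
    (hH : ∀ (p : ℕ) (hp : p.Prime), haveI : Fact p.Prime := ⟨hp⟩; ∀ j e, H p hp j e ≤ indTwo p (fun b => (I.σ.localFields p).k (e b)))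
    {p₀ : ℕ} (hp₀T : p₀ ∈ I.supportPrimes) (hp₀ : p₀.Prime) (hp2 : 2 < p₀)
    (i₁ : Fin I.lstar) (e₁ : haveI : Fact p₀.Prime := ⟨hp₀⟩; Fin ((i₁ : ℕ) + 1 + 1) → placesOver F₀ p₀)
    (he : haveI : Fact p₀.Prime := ⟨hp₀⟩; ∀ b, absRamificationIdx p₀ ((I.σ.localFields p₀).k (e₁ b)) ≤ p₀ - 2)
    {v : ℤ} (hv : haveI : Fact p₀.Prime := ⟨hp₀⟩; ‖(I.tΘ p₀ hp₀ i₁ (e₁ (Fin.last _)) : (I.σ.localFieldFamily p₀ hp₀).k (e₁ (Fin.last _)))‖ =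
      (p₀ : ℝ) ^ (-(v / (absRamificationIdx p₀ ((I.σ.localFields p₀).k (e₁ (Fin.last _))) : ℝ))))
    (S : Finset (Fin ((i₁ : ℕ) + 1 + 1)))
    (he2 : haveI : Fact p₀.Prime := ⟨hp₀⟩; ∀ b, b ∉ S → 2 ≤ absRamificationIdx p₀ ((I.σ.localFields p₀).k (e₁ b)))
    (hf : haveI : Fact p₀.Prime := ⟨hp₀⟩; ∀ b, b ∉ S → (I.σ.lift (e₁ b).1).asIdeal.inertiaDeg ℤ = 1)
    (hfix : haveI : Fact p₀.Prime := ⟨hp₀⟩; ∀ b, b ∉ S → ∀ ψ ∈ ind1StripOf (I.σ.lift (e₁ b).1) (galoisLog (I.σ.lift (e₁ b).1)),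
      RescaledCompletion.of K p₀ (I.σ.lift (e₁ b).1) (I.σ.natCast_mem_lift (e₁ b)) (ψ (p₀ : (I.σ.lift (e₁ b).1).adicCompletion K)) -
          (p₀ : RescaledCompletion K p₀ (I.σ.lift (e₁ b).1) (I.σ.natCast_mem_lift (e₁ b))) ∈
        (p₀ : ℚ_[p₀]) • logUnits (RescaledCompletion K p₀ (I.σ.lift (e₁ b).1) (I.σ.natCast_mem_lift (e₁ b))))
    (hnotroom : haveI : Fact p₀.Prime := ⟨hp₀⟩; ¬ ((((v - 1) % (absRamificationIdx p₀ ((I.σ.localFields p₀).k (e₁ (Fin.last _))) : ℤ) + 1 : ℤ) : ℝ) /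
        (absRamificationIdx p₀ ((I.σ.localFields p₀).k (e₁ (Fin.last _))) : ℝ) +
      ∑ b ∈ Finset.univ \ S, (1 : ℝ) / (absRamificationIdx p₀ ((I.σ.localFields p₀).k (e₁ b)) : ℝ) ≤ 1))
    (hHfac : haveI : Fact p₀.Prime := ⟨hp₀⟩; ∀ γ ∈ H p₀ hp₀ ((i₁ : ℕ) + 1) e₁, ∃ δ : Π b, AddAut ((I.σ.lift (e₁ b).1).adicCompletion K),
      (∀ b, δ b ∈ AddSubgroup.closure (G := AddAut ((I.σ.lift (e₁ b).1).adicCompletion K))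
        (ind1StripOf (I.σ.lift (e₁ b).1) (galoisLog (I.σ.lift (e₁ b).1)))) ∧
      ∀ z : Π b, (I.σ.localFields p₀).k (e₁ b),
        (γ : PacketAlgebra p₀ (fun b => (I.σ.localFields p₀).k (e₁ b)) ≃ₗ[ℚ_[p₀]]
            PacketAlgebra p₀ (fun b => (I.σ.localFields p₀).k (e₁ b))) (PiTensorProduct.tprod ℚ_[p₀] z) =
          PiTensorProduct.tprod ℚ_[p₀] (fun b => RescaledCompletion.of K p₀ (I.σ.lift (e₁ b).1) (I.σ.natCast_mem_lift (e₁ b))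
            (δ b ((RescaledCompletion.of K p₀ (I.σ.lift (e₁ b).1) (I.σ.natCast_mem_lift (e₁ b))).symm (z b))))) :
    (∑ p ∈ I.supportPrimes, if hp : p.Prime then
        (haveI : Fact p.Prime := ⟨hp⟩
        (I.packetAt p hp).lnνLp I.lstar (fun j e =>
          packetHull p (fun b => (I.σ.localFields p).k (e b))
            (⋃ g : H p hp j e, (g : PacketAlgebra p (fun b => (I.σ.localFields p).k (e b)) ≃ₗ[ℚ_[p]]
                PacketAlgebra p (fun b => (I.σ.localFields p).k (e b))) ''
              (I.packetAt p hp).pilotRegion (I.tΘ p hp) j e))) else 0) <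
      I.negLogThetaPerImageNonarch := by
  unfold negLogThetaPerImageNonarch
  refine Finset.sum_lt_sum (fun p hpT => ?_) ⟨p₀, hp₀T, ?_⟩
  · have hp : p.Prime := I.prime_of_mem_supportPrimes hpT
    rw [dif_pos hp]
    exact I.lnνLp_hull_orbitH_le_negLogThetaPerImageLoc hp (H p hp) (hH p hp)
  · rw [dif_pos hp₀]
    exact I.lnνLp_hull_orbitH_lt_negLogThetaPerImageLoc_of_not_room_mixed hp₀ hp2 (H p₀ hp₀) (hH p₀ hp₀) i₁ e₁ he hv S he2 hf hfix
      hnotroom hHfac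

/-- **GLOBAL STRICTNESS, reading (U) (UNCONDITIONAL).**  If at ONE support prime `p₀ > 2` ONE collection `v⃗₁ = e₁` has TAME factors, slot valuations
`‖t_{i₁,v_{1,a}}‖ = p₀^{−v_a/e_a}`, bits only on `S`, EVERY content-minimising slot FAILING its room inequality, and `H_{p₀,j₁,v⃗₁}` factorwise, then the
nonarchimedean Θ-side over `H` in reading (U) is STRICTLY below `−|log(Θ)|^{nonarch}` (R30 (ρ3) at `p₀`, §1 elsewhere). [claim: Mochizuki2012, status: disputed]
[cite: Mochizuki2012, IUTchIII Thm. 3.11 (i) p. 154; Cor. 3.12 p. 174; IUTchIV Prop. 1.4 (iii) p. 13] [cite: DupuyHilado2025, §1 (1.1), Def. 3.6.3, §4.11, §4.12] -/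
theorem sum_lnνLp_hull_orbitH_indOneUnion_lt_negLogThetaNonarch_of_not_room_at_min
    (H : ∀ (p : ℕ) (hp : p.Prime), haveI : Fact p.Prime := ⟨hp⟩
      (j : ℕ) → (e : Fin (j + 1) → placesOver F₀ p) →
        Subgroup (PacketAlgebra p (fun b => (I.σ.localFields p).k (e b)) ≃ₗ[ℚ_[p]]
          PacketAlgebra p (fun b => (I.σ.localFields p).k (e b))))
    (hH : ∀ (p : ℕ) (hp : p.Prime), haveI : Fact p.Prime := ⟨hp⟩; ∀ j e, H p hp j e ≤ indTwo p (fun b => (I.σ.localFields p).k (e b)))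
    {p₀ : ℕ} (hp₀T : p₀ ∈ I.supportPrimes) (hp₀ : p₀.Prime) (hp2 : 2 < p₀)
    (i₁ : Fin I.lstar) (e₁ : haveI : Fact p₀.Prime := ⟨hp₀⟩; Fin ((i₁ : ℕ) + 1 + 1) → placesOver F₀ p₀)
    (he : haveI : Fact p₀.Prime := ⟨hp₀⟩; ∀ b, absRamificationIdx p₀ ((I.σ.localFields p₀).k (e₁ b)) ≤ p₀ - 2)
    (v : Fin ((i₁ : ℕ) + 1 + 1) → ℤ)
    (hv : haveI : Fact p₀.Prime := ⟨hp₀⟩; ∀ a, ‖(I.tΘ p₀ hp₀ i₁ (e₁ a) : (I.σ.localFieldFamily p₀ hp₀).k (e₁ a))‖ =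
      (p₀ : ℝ) ^ (-(v a / (absRamificationIdx p₀ ((I.σ.localFields p₀).k (e₁ a)) : ℝ))))
    (S : Finset (Fin ((i₁ : ℕ) + 1 + 1)))
    (he2 : haveI : Fact p₀.Prime := ⟨hp₀⟩; ∀ b, b ∉ S → 2 ≤ absRamificationIdx p₀ ((I.σ.localFields p₀).k (e₁ b)))
    (hf : haveI : Fact p₀.Prime := ⟨hp₀⟩; ∀ b, b ∉ S → (I.σ.lift (e₁ b).1).asIdeal.inertiaDeg ℤ = 1)
    (hfix : haveI : Fact p₀.Prime := ⟨hp₀⟩; ∀ b, b ∉ S → ∀ ψ ∈ ind1StripOf (I.σ.lift (e₁ b).1) (galoisLog (I.σ.lift (e₁ b).1)),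
      RescaledCompletion.of K p₀ (I.σ.lift (e₁ b).1) (I.σ.natCast_mem_lift (e₁ b)) (ψ (p₀ : (I.σ.lift (e₁ b).1).adicCompletion K)) -
          (p₀ : RescaledCompletion K p₀ (I.σ.lift (e₁ b).1) (I.σ.natCast_mem_lift (e₁ b))) ∈
        (p₀ : ℚ_[p₀]) • logUnits (RescaledCompletion K p₀ (I.σ.lift (e₁ b).1) (I.σ.natCast_mem_lift (e₁ b))))
    (hnotroom : haveI : Fact p₀.Prime := ⟨hp₀⟩; ∀ a,
      (v a - 1) / (absRamificationIdx p₀ ((I.σ.localFields p₀).k (e₁ a)) : ℤ) + 1 - Fintype.card (Fin ((i₁ : ℕ) + 1 + 1)) =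
        Finset.univ.inf' Finset.univ_nonempty
          (fun a => (v a - 1) / (absRamificationIdx p₀ ((I.σ.localFields p₀).k (e₁ a)) : ℤ) + 1 - Fintype.card (Fin ((i₁ : ℕ) + 1 + 1))) →
      ¬ ((((v a - 1) % (absRamificationIdx p₀ ((I.σ.localFields p₀).k (e₁ a)) : ℤ) + 1 : ℤ) : ℝ) /
          (absRamificationIdx p₀ ((I.σ.localFields p₀).k (e₁ a)) : ℝ) +
        ∑ b ∈ Finset.univ \ S, (1 : ℝ) / (absRamificationIdx p₀ ((I.σ.localFields p₀).k (e₁ b)) : ℝ) ≤ 1))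
    (hHfac : haveI : Fact p₀.Prime := ⟨hp₀⟩; ∀ γ ∈ H p₀ hp₀ ((i₁ : ℕ) + 1) e₁, ∃ δ : Π b, AddAut ((I.σ.lift (e₁ b).1).adicCompletion K),
      (∀ b, δ b ∈ AddSubgroup.closure (G := AddAut ((I.σ.lift (e₁ b).1).adicCompletion K))
        (ind1StripOf (I.σ.lift (e₁ b).1) (galoisLog (I.σ.lift (e₁ b).1)))) ∧
      ∀ z : Π b, (I.σ.localFields p₀).k (e₁ b),
        (γ : PacketAlgebra p₀ (fun b => (I.σ.localFields p₀).k (e₁ b)) ≃ₗ[ℚ_[p₀]]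
            PacketAlgebra p₀ (fun b => (I.σ.localFields p₀).k (e₁ b))) (PiTensorProduct.tprod ℚ_[p₀] z) =
          PiTensorProduct.tprod ℚ_[p₀] (fun b => RescaledCompletion.of K p₀ (I.σ.lift (e₁ b).1) (I.σ.natCast_mem_lift (e₁ b))
            (δ b ((RescaledCompletion.of K p₀ (I.σ.lift (e₁ b).1) (I.σ.natCast_mem_lift (e₁ b))).symm (z b))))) :
    (∑ p ∈ I.supportPrimes, if hp : p.Prime then
        (haveI : Fact p.Prime := ⟨hp⟩
        (I.packetAt p hp).lnνLp I.lstar (fun j e =>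
          packetHull p (fun b => (I.σ.localFields p).k (e b))
            (⋃ g : H p hp j e, (g : PacketAlgebra p (fun b => (I.σ.localFields p).k (e b)) ≃ₗ[ℚ_[p]]
                PacketAlgebra p (fun b => (I.σ.localFields p).k (e b))) ''
              ⋃ τ : Equiv.Perm (Fin (j + 1)), (I.packetAt p hp).perm τ e '' (I.packetAt p hp).pilotRegion (I.tΘ p hp) j (e ∘ τ)))) else 0) <
      I.negLogThetaNonarch := by
  unfold negLogThetaNonarch
  refine Finset.sum_lt_sum (fun p hpT => ?_) ⟨p₀, hp₀T, ?_⟩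
  · have hp : p.Prime := I.prime_of_mem_supportPrimes hpT
    rw [dif_pos hp]
    exact I.lnνLp_hull_orbitH_indOneUnion_le_negLogThetaLoc hp (H p hp) (hH p hp)
  · rw [dif_pos hp₀]
    exact I.lnνLp_hull_orbitH_indOneUnion_lt_negLogThetaLoc_of_not_room_at_min hp₀ hp2 (H p₀ hp₀) (hH p₀ hp₀) i₁ e₁ he v hv S he2 hf
      hfix hnotroom hHfac

/-! ## §4 Claim-form transfer: Cor 3.12's nonarchimedean form over `H` implies Dupuy–Hilado's forms, strictly at failing data -/

/-- **CLAIM-FORM TRANSFER, reading (P).**  If «Cor 3.12's nonarchimedean form over `H`» holds — `−|log(q)| ≤ Σ_{p∈T(I)} ln ν̄_{𝕃_p}(reading (P) over H_p)` for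
some prime-indexed family `H ≤ indTwo` — then abc-iut-S2's Dupuy–Hilado form `Cor312PerImageNonarchOf I` holds (§2).  Bookkeeping between two `Prop`s; neither is
asserted. [claim: Mochizuki2012, status: disputed] [cite: Mochizuki2012, IUTchIII Cor. 3.12 pp. 173–174, Step (x) p. 181] [cite: DupuyHilado2025, §1 (1.1)] -/
theorem cor312PerImageNonarchOf_of_negAbsLogQ_le_sum
    (H : ∀ (p : ℕ) (hp : p.Prime), haveI : Fact p.Prime := ⟨hp⟩
      (j : ℕ) → (e : Fin (j + 1) → placesOver F₀ p) →
        Subgroup (PacketAlgebra p (fun b => (I.σ.localFields p).k (e b)) ≃ₗ[ℚ_[p]]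
          PacketAlgebra p (fun b => (I.σ.localFields p).k (e b))))
    (hH : ∀ (p : ℕ) (hp : p.Prime), haveI : Fact p.Prime := ⟨hp⟩; ∀ j e, H p hp j e ≤ indTwo p (fun b => (I.σ.localFields p).k (e b)))
    (hq : I.negAbsLogQ ≤ ∑ p ∈ I.supportPrimes, if hp : p.Prime then
        (haveI : Fact p.Prime := ⟨hp⟩
        (I.packetAt p hp).lnνLp I.lstar (fun j e =>
          packetHull p (fun b => (I.σ.localFields p).k (e b))
            (⋃ g : H p hp j e, (g : PacketAlgebra p (fun b => (I.σ.localFields p).k (e b)) ≃ₗ[ℚ_[p]]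
                PacketAlgebra p (fun b => (I.σ.localFields p).k (e b))) ''
              (I.packetAt p hp).pilotRegion (I.tΘ p hp) j e))) else 0) :
    I.Cor312PerImageNonarchOf :=
  le_trans hq (I.sum_lnνLp_hull_orbitH_le_negLogThetaPerImageNonarch H hH)

/-- **CLAIM-FORM TRANSFER, reading (U).**  «Cor 3.12's nonarchimedean form over `H`» in reading (U) implies abc-iut-S2's `Cor312NonarchOf I` (hence `Cor312Of I`,
`cor312Of_of_cor312NonarchOf`). [claim: Mochizuki2012, status: disputed] [cite: Mochizuki2012, IUTchIII Cor. 3.12 p. 174] [cite: DupuyHilado2025, §1 (1.1)] -/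
theorem cor312NonarchOf_of_negAbsLogQ_le_sum
    (H : ∀ (p : ℕ) (hp : p.Prime), haveI : Fact p.Prime := ⟨hp⟩
      (j : ℕ) → (e : Fin (j + 1) → placesOver F₀ p) →
        Subgroup (PacketAlgebra p (fun b => (I.σ.localFields p).k (e b)) ≃ₗ[ℚ_[p]]
          PacketAlgebra p (fun b => (I.σ.localFields p).k (e b))))
    (hH : ∀ (p : ℕ) (hp : p.Prime), haveI : Fact p.Prime := ⟨hp⟩; ∀ j e, H p hp j e ≤ indTwo p (fun b => (I.σ.localFields p).k (e b)))
    (hq : I.negAbsLogQ ≤ ∑ p ∈ I.supportPrimes, if hp : p.Prime then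
        (haveI : Fact p.Prime := ⟨hp⟩
        (I.packetAt p hp).lnνLp I.lstar (fun j e =>
          packetHull p (fun b => (I.σ.localFields p).k (e b))
            (⋃ g : H p hp j e, (g : PacketAlgebra p (fun b => (I.σ.localFields p).k (e b)) ≃ₗ[ℚ_[p]]
                PacketAlgebra p (fun b => (I.σ.localFields p).k (e b))) ''
              ⋃ τ : Equiv.Perm (Fin (j + 1)), (I.packetAt p hp).perm τ e '' (I.packetAt p hp).pilotRegion (I.tΘ p hp) j (e ∘ τ)))) else 0) :
    I.Cor312NonarchOf :=
  le_trans hq (I.sum_lnνLp_hull_orbitH_indOneUnion_le_negLogThetaNonarch H hH)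

end Literature.IUT.LogVolume.ThetaVolumeInput

end
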